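import Summits.ABC.StewartYu.ArchG3RecLinesB
import HarnessLib

/-!
# The archimedean record `ArchG3Rec` — letter lines in closed form, file C: THE DIRECTIONAL ATOMS

Support file (theorems only; no named facts). Cell `abc-stewartyu`, route `YuMatveevShapeRat`, crux r2 `ArchCoreRat`
(stmt-ABC-20502), line `arch-g3-frame`, seam (B) of `stub_recLinesArch` (p5's closed letters of `ArchG3RecLinesClosed`).
Upper bounds of the θ-charged atoms of the closed lines in the letters `N·L`, `Bexp = e^{W−1}`, `n!`:
* the box: `2Bv j + 1 ≤ (3/2)·N·L/A j` (as `1 ≤ N·L/(2A j)`), `A j ≤ N·L/2`; `(LνRR lev j/N)·A j ≤ (3/2)L/2^lev`, summed `≤ (3/2)·n·L/2^lev`;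
* `sRR k ≤ (3/2)·n!·N·L + 2`, `LbR lev k ≤ 2·sRR k`, `LbR lev k ≤ 4·n!·N·L`; `0 ≤ btR k ≤ n!·N·Bexp·Alast`;
* the weight ceiling `0 ≤ YR lev ≤ 10·n·n!·Bexp·N²·L` (no sorting needed);
(the sorted-weights atoms `yR`, `CR` and `cUR` are in file D).

## References
* [Nesterenko2003] Yu. V. Nesterenko, LNM 1819 (2003) — §3.4–3.5 (3.25), (3.36); §4.2 Lemma 4.3, (4.22); §4.3 (4.48).
-/

noncomputable section

open Finset Real
open scoped Nat

namespace Summit.ABC.StewartYu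

namespace ArchG3Rec

open PadicG3Par (Cb Cb_pos)
open ArchG3Par (G K yloadK G_eq G_pos K_pos yloadK_pos)

variable {n : ℕ} (P : ArchG3Rec n)

/-! ### The box -/

/-- **the box against the weights**: `2Bv j + 1 ≤ (3/2)·N·L/A j`, `A j ≤ N·L/2`, `2Bv j + 1 ≤ (3/2)·N·L`, `1 ≤ N·L/(2 A j)`. [folklore] -/
theorem box_le (j : Fin n) : 2 * (P.Bv j : ℝ) + 1 ≤ 3 / 2 * (P.N * P.L) / P.A j ∧ P.A j ≤ P.N * P.L / 2 ∧
    2 * (P.Bv j : ℝ) + 1 ≤ 3 / 2 * (P.N * P.L) ∧ 1 ≤ P.N * P.L / (2 * P.A j) := by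
  obtain ⟨-, h1, -, h2⟩ := P.box_facts j
  obtain ⟨hA0, hA1, -⟩ := P.A_facts j
  have hN := P.N_facts.1
  have e : P.N * P.σ j = P.N * P.L / (2 * P.A j) := by unfold σ; ring
  rw [e] at h1 h2
  have h3 : 2 * (P.Bv j : ℝ) + 1 ≤ 3 / 2 * (P.N * P.L) / P.A j := by
    have e2 : 3 / 2 * (P.N * P.L) / P.A j = 2 * (P.N * P.L / (2 * P.A j)) + P.N * P.L / (2 * P.A j) := by
      field_simp; ring
    rw [e2]; linarith
  have h4 : P.A j ≤ P.N * P.L / 2 := by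
    have := (lt_div_iff₀ (by positivity)).mp h1
    rw [le_div_iff₀ (by norm_num)]; linarith
  refine ⟨h3, h4, h3.trans ?_, h1.le⟩
  exact div_le_self (by positivity) hA1

/-- **the virtual schedule against the weights**: `(LνRR lev j/N)·A j ≤ (3/2)·L/2^lev` and `Σⱼ (LνRR lev j/N)·A j ≤ (3/2)·n·L/2^lev`. [folklore] -/
theorem LνRR_A_le (lev : ℕ) : (∀ j, (P.LνRR lev j : ℝ) / P.N * P.A j ≤ 3 / 2 * P.L / 2 ^ lev) ∧
    ∑ j, (P.LνRR lev j : ℝ) / P.N * P.A j ≤ 3 / 2 * n * P.L / 2 ^ lev ∧ 0 ≤ ∑ j, (P.LνRR lev j : ℝ) / P.N * P.A j := by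
  have hN := P.N_facts.1
  have h1 : ∀ j, (P.LνRR lev j : ℝ) / P.N * P.A j ≤ 3 / 2 * P.L / 2 ^ lev := by
    intro j
    obtain ⟨hb, -, -, -⟩ := P.box_le j
    have hA0 := (P.A_facts j).1
    have h2 : (P.LνRR lev j : ℝ) ≤ (2 * (P.Bv j : ℝ) + 1) / 2 ^ lev := by
      unfold LνRR
      have := Nat.cast_div_le (m := 2 * P.Bv j + 1) (n := 2 ^ lev) (α := ℝ)
      push_cast at this; exact this
    have h3 : (P.LνRR lev j : ℝ) ≤ 3 / 2 * (P.N * P.L) / P.A j / 2 ^ lev :=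
      h2.trans (div_le_div_of_nonneg_right hb (by positivity))
    calc (P.LνRR lev j : ℝ) / P.N * P.A j ≤ 3 / 2 * (P.N * P.L) / P.A j / 2 ^ lev / P.N * P.A j :=
          mul_le_mul_of_nonneg_right (div_le_div_of_nonneg_right h3 hN.le) hA0.le
      _ = 3 / 2 * P.L / 2 ^ lev := by field_simp
  refine ⟨h1, ?_, sum_nonneg fun j _ => by have := (P.A_facts j).1; positivity⟩
  calc ∑ j, (P.LνRR lev j : ℝ) / P.N * P.A j ≤ ∑ _j : Fin n, (3 / 2 * (P.L : ℝ) / 2 ^ lev) := sum_le_sum fun j _ => h1 j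
    _ = 3 / 2 * n * P.L / 2 ^ lev := by simp; ring

/-! ### The θ-box -/

/-- `(n−1)!·(n−1) + 1 ≤ n!` and `1 ≤ (n−1)!` (real). [folklore] -/
theorem fact_pred_le (hn : 1 ≤ n) : (((n - 1)! : ℕ) : ℝ) * (n - 1) + 1 ≤ (n ! : ℝ) ∧ (1 : ℝ) ≤ ((n - 1)! : ℕ) := by
  obtain ⟨m, rfl⟩ : ∃ m, n = m + 1 := ⟨n - 1, by omega⟩
  simp only [Nat.add_sub_cancel]
  have e : ((m + 1)! : ℝ) = (m + 1) * (m ! : ℝ) := by rw [Nat.factorial_succ]; push_cast; ring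
  have h1 : (1 : ℝ) ≤ (m ! : ℝ) := by exact_mod_cast Nat.one_le_iff_ne_zero.mpr (Nat.factorial_ne_zero m)
  refine ⟨?_, h1⟩
  rw [e]; push_cast; nlinarith

/-- **`sRR k ≤ (3/2)·n!·N·L + 2`** (each `2Bv j + 1 ≤ (3/2)NL`, `#{j > k} ≤ n − 1`, `(n−1)!(n−1) + 1 ≤ n!`). [folklore] -/
theorem sRR_le (k : Fin n) : (P.sRR k : ℝ) ≤ 3 / 2 * n ! * (P.N * P.L) + 2 ∧ (0 : ℝ) ≤ P.sRR k := by
  obtain ⟨hf, hf1⟩ := fact_pred_le P.hn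
  have hb := fun j => (P.box_le j).2.2.1
  have hNL : 0 ≤ P.N * (P.L : ℝ) := by have := P.N_facts.1; positivity
  have hcard_nat : (Ioi k).card ≤ n - 1 := by
    have : (Ioi k).card < n := by
      have : (Ioi k).card < (univ : Finset (Fin n)).card :=
        card_lt_card (ssubset_of_subset_of_ne (subset_univ _) fun h' => by
          have : k ∈ Ioi k := by rw [h']; exact mem_univ _
          simp at this)
      simpa using this
    omega
  have hcard : ((Ioi k).card : ℝ) ≤ n - 1 := by
    have : ((Ioi k).card : ℝ) ≤ ((n - 1 : ℕ) : ℝ) := by exact_mod_cast hcard_nat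
    rw [Nat.cast_sub P.hn] at this; simpa using this
  have hsum : ∑ j ∈ Ioi k, (2 * (P.Bv j : ℝ) + 1) ≤ (n - 1) * (3 / 2 * (P.N * P.L)) := by
    calc ∑ j ∈ Ioi k, (2 * (P.Bv j : ℝ) + 1) ≤ ∑ _j ∈ Ioi k, (3 / 2 * ((P.N : ℝ) * P.L)) := sum_le_sum fun j _ => hb j
      _ = (Ioi k).card * (3 / 2 * (P.N * P.L)) := by rw [sum_const, nsmul_eq_mul]
      _ ≤ (n - 1) * (3 / 2 * (P.N * P.L)) := mul_le_mul_of_nonneg_right hcard (by positivity)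
  refine ⟨?_, Nat.cast_nonneg _⟩
  unfold sRR; push_cast
  have hk := hb k
  have hf0 : (0 : ℝ) ≤ ((n - 1)! : ℕ) := Nat.cast_nonneg _
  calc (((n - 1)! : ℕ) : ℝ) * ∑ j ∈ Ioi k, (2 * (P.Bv j : ℝ) + 1) + (2 * (P.Bv k : ℝ) + 1) + 2
      ≤ ((n - 1)! : ℕ) * ((n - 1) * (3 / 2 * (P.N * P.L))) + 3 / 2 * (P.N * P.L) + 2 := by
        gcongr
    _ = ((((n - 1)! : ℕ) : ℝ) * (n - 1) + 1) * (3 / 2 * (P.N * P.L)) + 2 := by ring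
    _ ≤ n ! * (3 / 2 * (P.N * P.L)) + 2 := by gcongr
    _ = 3 / 2 * n ! * (P.N * P.L) + 2 := by ring

/-- **`LbR lev k ≤ 2·sRR k/2^lev ≤ 2·sRR k`**, hence `LbR lev k ≤ 4·n!·N·L` (`N·L ≥ 4`). [folklore] -/
theorem LbR_le (lev : ℕ) (k : Fin n) : (P.LbR lev k : ℝ) ≤ 2 * (P.sRR k : ℝ) / 2 ^ lev ∧ (P.LbR lev k : ℝ) ≤ 2 * P.sRR k ∧
    (P.LbR lev k : ℝ) ≤ 4 * n ! * (P.N * P.L) ∧ (0 : ℝ) ≤ P.LbR lev k := by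
  obtain ⟨hs, hs0⟩ := P.sRR_le k
  have h1 : (P.LbR lev k : ℝ) ≤ 2 * (P.sRR k : ℝ) / 2 ^ lev := by
    unfold LbR
    have := Nat.cast_div_le (m := 2 * P.sRR k) (n := 2 ^ lev) (α := ℝ)
    push_cast at this; exact this
  have h2 : 2 * (P.sRR k : ℝ) / 2 ^ lev ≤ 2 * P.sRR k :=
    div_le_self (by positivity) (one_le_pow₀ (by norm_num))
  have hNL : (4 : ℝ) ≤ P.N * P.L := by
    have hN := P.N_facts.2.1
    have hL := P.L_real.2.2.1
    have h4 : (4 : ℝ) ≤ 2 ^ (n + 25) := le_trans (by norm_num) (pow_le_pow_right₀ (by norm_num) (by omega : 2 ≤ n + 25))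
    nlinarith
  have hf1 : (1 : ℝ) ≤ n ! := by exact_mod_cast Nat.one_le_iff_ne_zero.mpr (Nat.factorial_ne_zero n)
  refine ⟨h1, h1.trans h2, (h1.trans h2).trans ?_, Nat.cast_nonneg _⟩
  nlinarith

/-- `Alast` facts: `1 ≤ Alast ≤ Ω`, `Alast ≤ N·L/2`, `2Bv jl + 3 ≤ (3/2)NL/Alast + 3`, `(2Bv jl + 1)/N + 2 ≤ (3/2)L/Alast + 2`; `1 ≤ Bexp`.
[folklore] -/
theorem Alast_facts : 1 ≤ P.Alast ∧ P.Alast ≤ P.Ω ∧ P.Alast ≤ P.N * P.L / 2 ∧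
    2 * (P.Bv P.jl : ℝ) + 3 ≤ 3 / 2 * (P.N * P.L) / P.Alast + 3 ∧
    (2 * (P.Bv P.jl : ℝ) + 1) / P.N + 2 ≤ 3 / 2 * P.L / P.Alast + 2 ∧ 1 ≤ P.Bexp := by
  obtain ⟨hb, hA2, -, -⟩ := P.box_le P.jl
  obtain ⟨hA0, hA1, hAm⟩ := P.A_facts P.jl
  have hN := P.N_facts.1
  have hΩ := P.Ω_facts.2.2.1
  refine ⟨hA1, hAm.trans hΩ, hA2, by unfold Alast; linarith, ?_, ?_⟩
  · unfold Alast
    have : (2 * (P.Bv P.jl : ℝ) + 1) / P.N ≤ 3 / 2 * (P.N * P.L) / P.A P.jl / P.N := div_le_div_of_nonneg_right hb hN.le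
    have e : 3 / 2 * (P.N * P.L) / P.A P.jl / P.N = 3 / 2 * P.L / P.A P.jl := by field_simp
    linarith
  · unfold Bexp; exact Real.one_le_exp (by linarith [P.hW])

/-- **`0 ≤ btR k ≤ n!·N·Bexp·Alast`** (`1/A j ≤ 1`, `#{j > k} ≤ n − 1`). [folklore] -/
theorem btR_le (k : Fin n) : 0 ≤ P.btR k ∧ P.btR k ≤ n ! * P.N * P.Bexp * P.Alast := by
  obtain ⟨hf, hf1⟩ := fact_pred_le P.hn
  obtain ⟨hAl1, -, -, -, -, hB1⟩ := P.Alast_facts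
  have hN := P.N_facts.1
  have hA := P.A_facts
  have hs0 : 0 ≤ ∑ j ∈ Ioi k, 1 / P.A j := sum_nonneg fun j _ => by have := (hA j).1; positivity
  have hs : ∑ j ∈ Ioi k, 1 / P.A j ≤ n - 1 := by
    have hcard : (Ioi k).card ≤ n - 1 := by
      have : (Ioi k).card < n := by
        have : (Ioi k).card < (univ : Finset (Fin n)).card :=
          card_lt_card (ssubset_of_subset_of_ne (subset_univ _) fun h' => by
            have : k ∈ Ioi k := by rw [h']; exact mem_univ _
            simp at this)
        simpa using this
      omega
    calc ∑ j ∈ Ioi k, 1 / P.A j ≤ ∑ _j ∈ Ioi k, (1 : ℝ) :=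
          sum_le_sum fun j _ => (div_le_one (hA j).1).mpr (hA j).2.1
      _ = (Ioi k).card := by simp
      _ ≤ ((n - 1 : ℕ) : ℝ) := by exact_mod_cast hcard
      _ = n - 1 := by rw [Nat.cast_sub P.hn]; simp
  have hk : 1 / P.A k ≤ 1 := (div_le_one (hA k).1).mpr (hA k).2.1
  have hc : 0 ≤ P.N * P.Bexp * P.Alast := by positivity
  have hf0 : (0 : ℝ) ≤ ((n - 1)! : ℕ) := Nat.cast_nonneg _
  refine ⟨?_, ?_⟩
  · unfold btR
    have hk0 : 0 ≤ P.N * P.Bexp * P.Alast / P.A k := div_nonneg hc (hA k).1.le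
    have : 0 ≤ (((n - 1)! : ℕ) : ℝ) * P.N * P.Bexp * P.Alast * ∑ j ∈ Ioi k, 1 / P.A j := by
      have e : (((n - 1)! : ℕ) : ℝ) * P.N * P.Bexp * P.Alast * ∑ j ∈ Ioi k, 1 / P.A j =
          (((n - 1)! : ℕ) : ℝ) * (P.N * P.Bexp * P.Alast) * ∑ j ∈ Ioi k, 1 / P.A j := by ring
      rw [e]; exact mul_nonneg (mul_nonneg hf0 hc) hs0
    linarith
  unfold btR
  calc (((n - 1)! : ℕ) : ℝ) * P.N * P.Bexp * P.Alast * ∑ j ∈ Ioi k, 1 / P.A j + P.N * P.Bexp * P.Alast / P.A k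
      = (P.N * P.Bexp * P.Alast) * ((((n - 1)! : ℕ) : ℝ) * ∑ j ∈ Ioi k, 1 / P.A j + 1 / P.A k) := by ring
    _ ≤ (P.N * P.Bexp * P.Alast) * ((((n - 1)! : ℕ) : ℝ) * (n - 1) + 1) := by
        apply mul_le_mul_of_nonneg_left _ hc; gcongr
    _ ≤ (P.N * P.Bexp * P.Alast) * n ! := mul_le_mul_of_nonneg_left hf hc
    _ = n ! * P.N * P.Bexp * P.Alast := by ring

/-- **the weight ceiling `0 ≤ YR lev ≤ 10·n·n!·Bexp·N²·L`** (`B·N·LbR ≤ 4n!BN²L`, `2btR(2Bv jl+3) ≤ 6n!BN²L`). [cite: Nesterenko2003, (3.36); shape only] -/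
theorem YR_le (lev : ℕ) : 0 ≤ P.YR lev ∧ P.YR lev ≤ 10 * n * n ! * P.Bexp * P.N ^ 2 * P.L := by
  obtain ⟨hAl1, -, hAl2, hjl, -, hB1⟩ := P.Alast_facts
  have hN := P.N_facts
  have hL := P.L_real
  have hterm : ∀ k, 0 ≤ P.Bexp * P.N * (P.LbR lev k : ℝ) + 2 * P.btR k * (2 * P.Bv P.jl + 3 : ℝ) ∧
      P.Bexp * P.N * (P.LbR lev k : ℝ) + 2 * P.btR k * (2 * P.Bv P.jl + 3 : ℝ) ≤ 10 * n ! * P.Bexp * P.N ^ 2 * P.L := by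
    intro k
    obtain ⟨-, -, hLb, hLb0⟩ := P.LbR_le lev k
    obtain ⟨hbt0, hbt⟩ := P.btR_le k
    refine ⟨by positivity, ?_⟩
    have h1 : P.Bexp * P.N * (P.LbR lev k : ℝ) ≤ P.Bexp * P.N * (4 * n ! * (P.N * P.L)) :=
      mul_le_mul_of_nonneg_left hLb (by positivity)
    -- `btR·(2Bv jl + 3) ≤ n! N B Alast ((3/2)NL/Alast + 3) = n! N B ((3/2) NL + 3 Alast) ≤ 3 n! B N² L`
    have h2 : P.btR k * (2 * P.Bv P.jl + 3 : ℝ) ≤ n ! * P.N * P.Bexp * (3 / 2 * (P.N * P.L) + 3 * P.Alast) := by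
      calc P.btR k * (2 * P.Bv P.jl + 3 : ℝ) ≤ (n ! * P.N * P.Bexp * P.Alast) * (3 / 2 * (P.N * P.L) / P.Alast + 3) :=
            mul_le_mul hbt hjl (by positivity) (by positivity)
        _ = n ! * P.N * P.Bexp * (3 / 2 * (P.N * P.L) + 3 * P.Alast) := by field_simp
    have h3 : 3 / 2 * (P.N * P.L) + 3 * P.Alast ≤ 3 * (P.N * P.L) := by linarith
    have hf0 : (0 : ℝ) ≤ n ! * P.N * P.Bexp := by positivity
    nlinarith [mul_le_mul_of_nonneg_left h3 hf0]
  refine ⟨sum_nonneg fun k _ => (hterm k).1, ?_⟩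
  unfold YR
  calc ∑ k, (P.Bexp * P.N * (P.LbR lev k : ℝ) + 2 * P.btR k * (2 * P.Bv P.jl + 3 : ℝ))
      ≤ ∑ _k : Fin n, 10 * n ! * P.Bexp * P.N ^ 2 * P.L := sum_le_sum fun k _ => (hterm k).2
    _ = 10 * n * n ! * P.Bexp * P.N ^ 2 * P.L := by simp; ring

end ArchG3Rec

end Summit.ABC.StewartYu
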